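import Summits.HodgeConjecture.HodgeConjecture.Theorems.CyclicUnitaryPowersDeckUnitaryCayleyAscent
import Summits.HodgeConjecture.HodgeConjecture.Theorems.CyclicUnitaryPowersDeckUnitaryCommutatorGeneration
import Summits.HodgeConjecture.HodgeConjecture.Theorems.CyclicUnitaryPowersUnitaryTorusLemma
import Summits.HodgeConjecture.HodgeConjecture.Theorems.CyclicUnitaryPowersDeckUnitaryInvariantsMatching

/-!
# K2-A stub U `stub_unitaryHodgeTensorFFT` (lane 1 of line `unitary-kunneth-fft` v6) as the composite D₁ ⇒ D₂ ⇒ T ⇒ L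

Route `CyclicUnitaryPowers`, crux `PowersHodgeOfDeckCommutators` (stmt-HodgeConjecture-19545), skeleton v6
(sha16 `e821e1634d2d5d3d`).  The skeleton's lane-1 stub U (`UnitaryHodgeTensorFFT`, signature U″: an `SL`-type first
fundamental theorem WITH eigen-determinants for Hodge tensors fixed by the commutators of the deck-unitary `ℚ`-points) is,
by the skeleton's own sorry-free seams `deckUnitaryCommutatorDensity_of_D12` and `unitaryHodgeTensorFFT_of_DTL`, the
composite of the four lane-2 stubs, all LANDED: D₁ `stub_deckUnitaryCommutatorAscent` (p534578), D₂
`stub_deckUnitaryCommutatorGeneration` (p542072), T `stub_unitaryTorusLemma` (p549630), L `stub_deckUnitaryInvariantsMatching`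
(p554589).  This file lands U BY NAME (registered signature verbatim) so that every registered stub of the crux is a
tree theorem; the proof is the two seams with the landed theorems substituted (no new mathematics).

Mathematically: a Hodge tensor `t ∈ T^{r,0}H` fixed by every commutator `[g, h]` of `s`-commuting `Q`-isometries
(`ℚ`-points) is fixed by the derived deck-unitary group `D(U)(ℂ) = Π_j SL(V_j)` (Cayley ascent D₁ + generation D₂), hence —
being a Hodge class, via the Deligne torus, the affine eigen-Hodge offsets and `DetSupportsBalanced` — by the whole
connected deck-unitary group `U⁰(ℂ)` (T), hence lies in the `ℚ`-span of the cyclic matching tensors (`GL`-FFT, L).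

## References

* P. Deligne, *Hodge cycles on abelian varieties*, LNM 900 (1982), §3–§4 (Hodge group vs. Lefschetz group, Weil type).
  [cite: Deligne1982]
* J. S. Milne, *Lefschetz classes on abelian varieties*, Duke Math. J. 96 (1999), Prop. 3.6 (c). [cite: Milne1999]
* R. Goodman, N. Wallach, *Symmetry, Representations, and Invariants*, GTM 255, Thm. 5.2.1 / Thm. 5.3.1.
  [cite: GoodmanWallachGTM255]
-/

-- `Summit.HodgeConjecture.HodgeConjecture.Theorems` is the mandated namespace (single-problem summit), which
-- `linter.dupNamespace` flags; the lakefile turns the linter off tree-wide, restated here for stand-alone checks.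
set_option linter.dupNamespace false

noncomputable section

open Literature.AlgebraicGeometry.Motives Literature.AlgebraicGeometry.HodgeTheory
open Literature.AlgebraicGeometry.HodgeTheory.BettiUniverse
open CategoryTheory CategoryTheory.Limits
open scoped TensorProduct PiTensorProduct BigOperators

namespace Summit.HodgeConjecture.HodgeConjecture.Theorems.CyclicUnitaryPowersUnitaryHodgeTensorFFT

/-- **K2-A stub U `stub_unitaryHodgeTensorFFT`** (registered signature U″ verbatim): every Hodge tensor of `T^{r,0}V`
fixed by the commutators of the deck-unitary `ℚ`-points is a `ℚ`-combination of cyclic matching tensors — the composite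
D₁ ⇒ D₂ ⇒ T ⇒ L of the landed lane-2 theorems. [cite: Deligne1982, §3–§4] [cite: Milne1999, Prop. 3.6 (c)]
[cite: GoodmanWallachGTM255, Thm. 5.3.1] -/
theorem stub_unitaryHodgeTensorFFT :
    open Literature.AlgebraicGeometry.Motives Literature.AlgebraicGeometry.HodgeTheory Literature.AlgebraicGeometry.HodgeTheory.BettiUniverse CategoryTheory.Limits in ∀ (V : Type) [AddCommGroup V] [Module ℚ V] [Module.Finite ℚ V] [HodgeTensorFacts.{0, 0}] (H : HodgeStructure V ((2 : ℕ) : ℤ)) (Q : LinearMap.BilinForm ℚ V) (s : V →ₗ[ℚ] V) (p : ℕ) (e : ℕ → ℕ → ℕ), p.Prime → 3 ≤ p → Q.Nondegenerate → (∀ x y, Q x y = Q y x) → (∀ (a b : ℤ) (x y : ℂ ⊗[ℚ] V), x ∈ H.F a → y ∈ H.F b → 3 ≤ a + b → LinearMap.BilinForm.baseChange ℂ Q x y = 0) → s ^ p = 1 → (∀ x y, Q (s x) (s y) = Q x y) → (∀ a : ℤ, (H.F a).map (s.baseChange ℂ) ≤ H.F a) → H.F 3 = ⊥ → Module.finrank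 ℚ ↥(Module.End.eigenspace s 1) = 1 → (∃ ζ : ℂ, IsPrimitiveRoot ζ p ∧ ∀ j q : ℕ, 1 ≤ j → j < p → q ≤ 2 → Module.finrank ℂ ↥(Module.End.eigenspace (s.baseChange ℂ) (ζ ^ j) ⊓ H.piece ((2 : ℤ) - q) q) = e j q) → (∃ c : ℤ, c ≠ 0 ∧ ∀ j ∈ Finset.Ico 1 p, 2 * ((e j 0 : ℤ) - (e j 2 : ℤ)) = c * ((p : ℤ) - 2 * (j : ℤ))) → (∀ c : ℤ, c ≠ 0 → ∀ m : ℕ → ℤ, (∀ t ∈ Finset.Ico 1 p, ∑ j ∈ Finset.Ico 1 p, m j * (c * ((p : ℤ) - 2 * ((t * j % p : ℕ) : ℤ))) = 0) → ∀ j ∈ Finset.Ico 1 p, m j = m (p - j)) → ∀ (r : ℕ) (t : hodgeTensorSpace V r 0), (∃ p' : ℤ, ((r : ℤ) - ((0 : ℕ) : ℤ)) * ((2 : ℕ) : ℤ) = 2 * p' ∧ t ∈ (H.tensorSpace r 0).hodgeClasses p') → (∀ g h : V ≃ₗ[ℚ] V, (∀ x, g (s x) = s (g x)) → (∀ x y,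 Q (g x) (g y) = Q x y) → (∀ x, h (s x) = s (h x)) → (∀ x y, Q (h x) (h y) = Q x y) → tensorSpaceAct (g * h * g⁻¹ * h⁻¹) t = t) → t ∈ Submodule.span ℚ {m : hodgeTensorSpace V r 0 | ∃ (j l : ℕ) (ε : Fin r ≃ (Fin 2 × Fin j) ⊕ Fin l) (τ : Fin j → Fin p) (z : Fin l → V) (_ : ∀ a, s (z a) = z a), m = (∑ w : Fin r → Fin (Module.finrank ℚ V), ((∏ c : Fin j, (LinearMap.toMatrix (Module.finBasis ℚ V) (Module.finBasis ℚ V) (s ^ ((τ c : Fin p) : ℕ)) * (Matrix.of fun a a' => Q ((Module.finBasis ℚ V) a) ((Module.finBasis ℚ V) a'))⁻¹) (w (ε.symm (Sum.inl (0, c)))) (w (ε.symm (Sum.inl (1, c))))) * ∏ a : Fin l, ((Module.finBasis ℚ V).repr (z a)) (w (ε.symm (Sum.inr a)))) • ((PiTensorProduct.tprod ℚ fun i => (Module.finBasis ℚ V) (w i)) ⊗ₜ[ℚ] (PiTensorProduct.tprod ℚ fun i : Fin 0 => (Fin.elim0 i : Module.Dual ℚ V))))} := by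
  intro V _ _ _ _ H Q s p e hp h3 hQ hQs hQF hsp hsQ hsF hF3 hfix hζe hc hBal r t ht hComm
  obtain ⟨ζ, hζ, hnum⟩ := hζe
  -- D₁ ⇒ D₂: invariance under the derived deck-unitary group `D(U)(ℂ)`
  have h1 := CyclicUnitaryPowersDeckUnitaryCommutatorGeneration.stub_deckUnitaryCommutatorGeneration V Q s p hp h3 hQ
    hQs hsp hsQ hfix ζ hζ r t
    (CyclicUnitaryPowersDeckUnitaryCayleyAscent.stub_deckUnitaryCommutatorAscent V Q s p hp h3 hQ hQs hsp hsQ r t hComm)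
  -- T: invariance under the connected deck-unitary group `U⁰(ℂ)`
  have h2 := CyclicUnitaryPowersUnitaryTorusLemma.stub_unitaryTorusLemma V H Q s p e hp h3 hQ hQs hQF hsp hsQ hsF hF3
    hfix ⟨ζ, hζ, hnum⟩ hc hBal ζ hζ r t ht h1
  -- L: the matching span
  exact CyclicUnitaryPowersDeckUnitaryInvariantsMatching.stub_deckUnitaryInvariantsMatching V Q s p hp h3 hQ hQs hsp
    hsQ hfix r t h2

end Summit.HodgeConjecture.HodgeConjecture.Theorems.CyclicUnitaryPowersUnitaryHodgeTensorFFT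

end
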